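import Summits.AnomalousDissipation.AnomalousDissipation.Theorems.SolenoidalFractalHomogenisationLagrangianCarrierConstructionRegularLUnique
import Summits.AnomalousDissipation.AnomalousDissipation.Theorems.SolenoidalFractalHomogenisationLagrangianCarrierConstructionRegularLReduction
import Summits.AnomalousDissipation.AnomalousDissipation.Theorems.SolenoidalFractalHomogenisationLagrangianCarrierConstructionFlowsLRegularT
import HarnessLib

/-!
# K3L `LagrangianCarrierConstruction` (stmt-AnomalousDissipation-24913), line `birth`, stub `stub_regularL`: transfer from the tower and
# `stub_regularL` MODULO the quantitative level bounds (helper; `--supports stmt-AnomalousDissipation-24913`)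

Summits-side helper file (everything proved; no definitions, no named facts). Puts the three `RegularL*` bricks together:
* `periodic_b_of_isLagrangian`: the abstract carrier of `stub_regularL`'s hypotheses (`IsLagrangian` + (L1), (L3a), (L3b), (F1a) + (W1), (W2))
  has ALL its level fields time periodic with the COMMON period `refresh 1` — by uniqueness of the Lagrangian insertion
  (`…RegularLUnique.isLagrangian_unique`) it IS the Lagrangian tower of `…FlowsLRegularT.exists_isLagrangian_levelRegular_T`, whose levels are.
* `regular_of_isLagrangian_of_levelBounds`: the registered `stub_regularL` (skeleton r23 v6) with its conclusion `E.Regular` derived from its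
  own hypotheses PLUS the one quantitative input of `…RegularLReduction.regular_of_levelBounds` (a summable majorant `ρ` of the `C^{0,r}` norms of
  the level fields and their `C^{0,r}`-continuity in time). What remains of `stub_regularL` is therefore exactly the Armstrong–Vicol §5.1
  distortion estimate producing `ρ` from the strain clause (S), `N_m² ≤ N_{m+1}`, (T4) and the amplitude decay — a crux-sized item.
Infrastructure for route-1's rung leaf F-D1.A0 (a frontier FORMAL rung); NOT a proof of anomalous dissipation.
-/

set_option linter.dupNamespace false

noncomputable section

namespace Summit.AnomalousDissipation.AnomalousDissipation.Theorems.SolenoidalFractalHomogenisation.LagrangianCarrierConstruction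

open Set Function Filter Topology MeasureTheory
open scoped NNReal ENNReal
open Literature.Analysis Literature.Analysis.FunctionSpaces Literature.Analysis.FunctionSpaces.Torus
open Literature.Analysis.FluidPDE Literature.Analysis.FluidPDE.LatticeShear

variable {k : ℕ}

/-- **Common time period of the abstract Lagrangian carrier.** [cite: ArmstrongVicol2025, §2.2 (PDF p. 12: the windows τ″_m are nested and
commensurable with the periods, so b is time periodic)] -/
theorem periodic_b_of_isLagrangian (E : LagrangianLatticeCarrier k)
    (hW1 : ∀ m, ∃ r : ℕ, 0 < r ∧ E.refresh (m + 1) = (r : ℝ) * E.toFractalCarrierData.physPeriod (m + 1))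
    (hW2 : ∀ m, ∃ q : ℕ, 0 < q ∧ E.refresh m = (q : ℝ) * E.refresh (m + 1)) (hL : E.IsLagrangian)
    (h1 : ∀ m, Continuous (uncurry (E.b (m + 1)))) (h3a : ∀ m t, IsSmooth (E.b (m + 1) t))
    (h3b : ∀ m (n : ℕ), ∃ C : ℝ, ∀ t y, ‖iteratedFDeriv ℝ n (Torus.lift (E.b (m + 1) t)) y‖ ≤ C)
    (hF1a : ∀ m s, Continuous fun p : ℝ × UnitAddTorus (Fin 3) => E.disp m p.1 s p.2) (m : ℕ) :
    Function.Periodic (E.b (m + 1)) (E.refresh 1) := by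
  obtain ⟨E', hdata, hR, -, hL', h1', -, h3a', h3b', -, hF1a', -, -, -, -, -, hper'⟩ :=
    exists_isLagrangian_levelRegular_T k E hW1 hW2
  obtain ⟨hb, -⟩ := isLagrangian_unique E E' hdata hR hL hL' h1 h3a h3b hF1a h1' h3a' h3b' hF1a'
  rw [← hb m]
  exact hper' m

/-- **`stub_regularL` modulo the quantitative level bounds.** The hypotheses are those of the registered stub `stub_regularL` (skeleton r23 v6,
in its order), followed by the quantitative input: an exponent `r > 0`, a summable nonnegative `ρ` with `‖b (m+1) t x‖ ≤ ρ m` and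
`‖b (m+1) t‖_{C^{0,r}} ≤ ρ m`, and `C^{0,r}`-continuity of every level in time; the conclusion is `E.Regular`.
[cite: ArmstrongVicol2025, Thm. 1.1 (regularity class of the carrier) and §2.2 (PDF p. 18), §5.1 (the distortion estimates that produce ρ)] -/
theorem regular_of_isLagrangian_of_levelBounds (E : LagrangianLatticeCarrier k) (hL : E.IsLagrangian)
    (h1 : ∀ m, Continuous (Function.uncurry (E.b (m + 1))))
    (h2 : ∀ m t, Torus.IsWeaklyDivFree (E.b (m + 1) t))
    (h3a : ∀ m t, Torus.IsSmooth (E.b (m + 1) t))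
    (h3b : ∀ m (n : ℕ), ∃ C : ℝ, ∀ t y, ‖iteratedFDeriv ℝ n (Torus.lift (E.b (m + 1) t)) y‖ ≤ C)
    (h4 : ∀ m, ∃ τ : ℝ, 0 < τ ∧ Function.Periodic (E.b (m + 1)) τ)
    (hF1a : ∀ m s, Continuous fun p : ℝ × UnitAddTorus (Fin 3) => E.disp m p.1 s p.2)
    (hF1b : ∀ m t s, Torus.IsSmooth (E.disp m t s))
    (hF1c : ∀ m (n : ℕ) (j : ℤ), ∃ C : ℝ, ∀ t ∈ E.window (m + 1) j, ∀ y,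
      ‖iteratedFDeriv ℝ n (Torus.lift (E.disp m t ((j : ℝ) * E.refresh (m + 1)))) y‖ ≤ C)
    (hF2a : ∀ m s, E.X m s s = id) (hF2b : ∀ m t s r, E.X m t s ∘ E.X m s r = E.X m t r)
    (hF2c : ∀ m t s, MeasurePreserving (E.X m t s) volume volume)
    (hW1 : ∀ m, ∃ r : ℕ, 0 < r ∧ E.refresh (m + 1) = (r : ℝ) * E.toFractalCarrierData.physPeriod (m + 1))
    (hW2 : ∀ m, ∃ q : ℕ, 0 < q ∧ E.refresh m = (q : ℝ) * E.refresh (m + 1))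
    {r : ℝ≥0} (hr : 0 < r) {ρ : ℕ → ℝ} (hρ0 : ∀ m, 0 ≤ ρ m) (hρ : Summable ρ)
    (hsup : ∀ m t x, ‖E.b (m + 1) t x‖ ≤ ρ m)
    (hhol : ∀ m t, eBoundedHolderNorm r (E.b (m + 1) t) ≤ ENNReal.ofReal (ρ m))
    (hcont : ∀ m t₀, Tendsto (fun t => eBoundedHolderNorm r (E.b (m + 1) t - E.b (m + 1) t₀)) (𝓝 t₀) (𝓝 0)) :
    E.Regular :=
  regular_of_levelBounds E h1 h2 h3a h3b h4 hF1a hF1b hF1c hF2a hF2b hF2c (E.refresh_pos 1)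
    (periodic_b_of_isLagrangian E hW1 hW2 hL h1 h3a h3b hF1a) hr hρ0 hρ hsup hhol hcont

end Summit.AnomalousDissipation.AnomalousDissipation.Theorems.SolenoidalFractalHomogenisation.LagrangianCarrierConstruction

end
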